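import Mathlib
import Summits.ValiantsHypothesis.ValiantsHypothesis.Theorems.NewtonUnitEquationsTwoProductsRadixCosetOn

/-!
# Radix residue on a coset for a difference of two multiscale products

For a difference of two multiscale products `D = F * expand M C₁ - G * expand M C₂`
(where `MvPolynomial.expand M` substitutes `x ↦ x^M`, `y ↦ y^M`) and a base point `s`, let
`ψ` and `χ` collect the coefficients of `F` and `G` on the coset `s + M • ℕ²`, i.e.
`coeff c ψ = coeff (s + M • c) F` and `coeff c χ = coeff (s + M • c) G`. If every exponent of
`F` (resp. `G`) that is congruent to `s` coordinatewise modulo `M` dominates `s`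
coordinatewise, then the coefficients of `D` on the coset `s + M • ℕ²` are those of the
smaller instance `ψ * C₁ - χ * C₂`:
`coeff (s + M • p) D = coeff p (ψ * C₁ - χ * C₂)`.

This is two applications of the one-product coset Mahler coefficient identity
(`RadixCosetOn.stub_radixCosetOn`) combined by `MvPolynomial.coeff_sub`.
-/

set_option linter.dupNamespace false

namespace Summit.ValiantsHypothesis.ValiantsHypothesis.Theorems.TwoProducts.RadixPairCosetOn

open Summit.ValiantsHypothesis.ValiantsHypothesis.Theorems.TwoProducts.RadixCosetOn

/-- **Coset Mahler coefficient identity for a difference of two products.** Let `M ≥ 1`, let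
`ψ` and `χ` collect the coefficients of `F` and `G` on the coset `s + M • ℕ²`
(`coeff c ψ = coeff (s + M • c) F`, `coeff c χ = coeff (s + M • c) G`), and assume every
exponent `d` in the support of `F` or of `G` with `d ≡ s` coordinatewise modulo `M` satisfies
`s ≤ d`. Then for every `p`, the coefficient of `F * expand M C₁ - G * expand M C₂` at
`s + M • p` equals the coefficient of `ψ * C₁ - χ * C₂` at `p`. -/
theorem stub_radixPairCosetOn : ∀ (M : ℕ) (F G ψ χ C₁ C₂ : MvPolynomial (Fin 2) ℂ) (s : Fin 2 →₀ ℕ), 1 ≤ M →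
    (∀ c : Fin 2 →₀ ℕ, MvPolynomial.coeff c ψ = MvPolynomial.coeff (s + M • c) F) →
    (∀ c : Fin 2 →₀ ℕ, MvPolynomial.coeff c χ = MvPolynomial.coeff (s + M • c) G) →
    (∀ d ∈ F.support, d 0 % M = s 0 % M → d 1 % M = s 1 % M → s ≤ d) →
    (∀ d ∈ G.support, d 0 % M = s 0 % M → d 1 % M = s 1 % M → s ≤ d) →
    ∀ p : Fin 2 →₀ ℕ, MvPolynomial.coeff (s + M • p) (F * MvPolynomial.expand M C₁ - G * MvPolynomial.expand M C₂) =
      MvPolynomial.coeff p (ψ * C₁ - χ * C₂) := by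
  intro M F G ψ χ C₁ C₂ s hM hψ hχ hF hG p
  rw [MvPolynomial.coeff_sub, MvPolynomial.coeff_sub,
    stub_radixCosetOn M F ψ C₁ s hM hψ hF p, stub_radixCosetOn M G χ C₂ s hM hχ hG p]

end Summit.ValiantsHypothesis.ValiantsHypothesis.Theorems.TwoProducts.RadixPairCosetOn
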